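import Mathlib
import Summits.ValiantsHypothesis.ValiantsHypothesis.Theorems.LacunarySymmetroidMatrixDescartesCensusTropicalKLaw
import Summits.ValiantsHypothesis.ValiantsHypothesis.Theorems.LacunarySymmetroidMatrixDescartesCensusTropicalKLawStatic

/-!
# Route «KPlusLogSqLaw» — the STATIC three-class family MOUNTAIN: definitions

HONEST FRAMING.  Helper chain of the object-search cell `pub-symmetroid` (seat val-sym-lift-p1 g5, 2026-08-27) toward
the cruxes `WeakLifting` (ledger item `stmt-ValiantsHypothesis-19561`) / `TropicalB` (`stmt-ValiantsHypothesis-19771`) of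
route `KPlusLogSqLaw`, in the vocabulary of `…CensusTropicalKLaw` / `…CensusTropicalKLawStatic` (`TropRootLawAt`,
`TropRootLawAtStatic`, `IsStatic`, `IsDominant`, `termSign`, `tropWeight`).  It is a statement of FINITE TROPICAL
COMBINATORICS (an explicit dominance design per format `(m, 3)` and its chain); nothing here asserts or bears on `TropicalB`,
`WeakLifting`, `Lifting`, `KPlusLogSqLaw`, the cell's real census or registers (DoorA26 / DoorA34), `MatrixDescartes`
(`stmt-ValiantsHypothesis-18050`) or `VP ≠ VNP`.

THE DESIGN (nodes `Fin (n+1)`, `m = n + 1`; the lead desk's pre-registered kernel target R1574 «a static-sign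
permutation-only family attains the full `K = 3` tropical histogram count `C(m+2,2) − 2m` for all `m`», located numerically
by val-sym-lift-p1 g4 (HOME README (P1)) and re-designed here with a closed-form proof; brute-force replay of this exact
design for `m ≤ 10` in the seat folder, `tools/mountain_check.py`).
* STATIC SIGN RULE: the entry in row `a`, column `b` carries only the class `cls a b = [a = b ↦ 0 | a > b ↦ 1 | a < b ↦ 2]`
  (`ee`), so a Leibniz term is determined by its permutation; exponents `d = (0, 1, m+2)` (`dd`), whence the degree of a
  permutation with `y` excedances and `z` anti-excedances is `y + (m+2) z` (`Dg`) and the `C(m,2) + 1` feasible class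
  histograms `(m−y−z, y, z)` (`y, z ≥ 1`, `y + z ≤ m`, or `y = z = 0`) are ordered lexicographically by `(z, y)`.
* VALUATIONS (`val`, scale `Q = 2(m+1)²`): diagonal `0`; unit ascents `(b+1, b)` cost `0`; the column-`0` entry `(c, 0)`
  costs `Q^c − Q`; an upper entry `(a, b)`, `a < b`, costs `Q^a (Q − 1) + Q^(a+1)·C(b − a, 2)`; all other lower entries
  (long ascents off column `0`) are ABSENT (`sgn = 0`).
* THE MOUNTAINS (`mtn`, `mf` / `mg`): `M_(y,z)` = the cycle `0 → z → z+1 → ⋯ → z+y−1 → z−1 → ⋯ → 1 → 0`, identity on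
  `[y+z, m)`; it has `y` excedances, `z` anti-excedances, cost `W(y,z) = 2Q^z − Q − 1 + Q^z C(y,2)` (`Wv`) and is the
  unique optimum at the integer slope `θ(y,z) = Q^z·y − 1` (`th`); `M_(0,0) = 1` at `θ = −1`.
* SIGNS (`csign`, `lsign`, `sgn`): `+1` except on the column-`0` entries and the long descents, whose signs are DEFINED
  through `Equiv.Perm.sign` of the mountains using them (the device of `…TropicalShiftThreeDefs`), so that the chain's term
  signs are `(−1)^rank` with no cycle-sign computation.
* CHAIN (`step`, `grid`, rank function `R`): `(0,0), (1,1), (2,1), …, (m−1,1), (1,2), …, (1,m−1)` — `C(m,2) + 1` points;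
  bookkeeping functions `cost`, `deg`, `exc`, `aexc`, `land` (landing rows), `c0`, `gcost`, `gdeg`, `gaexc`, `gsgn`.
The companion files `…StaticMountainBasics/Counts/Hull/Dominance/Chain.lean` prove dominance, alternation and
`TropRootLawAtStatic m 3 B → C(m,2) ≤ B`.  These are concrete witnesses, not notions: no statement of the route depends
on them.
-/

-- `Summit.ValiantsHypothesis.ValiantsHypothesis.…` repeats a component by the D-0017 layout
-- (single-conjunct summit), which the `dupNamespace` linter flags; the name is mandated.
set_option linter.dupNamespace false
set_option autoImplicit false

namespace Summit.ValiantsHypothesis.ValiantsHypothesis.Theorems.LacunarySymmetroidMatrixDescartes.TropicalCensus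

open Summit.ValiantsHypothesis.ValiantsHypothesis.Theorems.MatrixDescartes.Negative
open scoped BigOperators
open Finset

namespace Mountain

variable (n : ℕ)

/-- the base of the valuation scale: `Q = 2(m+1)²` (`m = n + 1`). -/
def Q : ℤ := 2 * ((n : ℤ) + 2) ^ 2

/-- exponents `d = (0, 1, m + 2)`: class `0` = diagonal, class `1` = lower (excedance) entries, class `2` = upper
(anti-excedance) entries. -/
def dd : Fin 3 → ℕ := ![0, 1, n + 3]

/-- the STATIC SIGN RULE: the class of the entry in row `a`, column `b` is `0` if `a = b`, `1` if `a > b`, `2` if `a < b`. -/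
def cls (a b : Fin (n + 1)) : Fin 3 := if a = b then 0 else if (b : ℕ) < (a : ℕ) then 1 else 2

/-- valuations (costs): diagonal and unit ascents `(b+1, b)` cost `0`; the column-`0` entry `(c, 0)` costs `Q^c − Q`;
an upper entry `(a, b)`, `a < b`, costs `Q^a (Q − 1) + Q^(a+1)·C(b − a, 2)`; other lower entries (absent) cost `0`. -/
def val (a b : Fin (n + 1)) : ℤ :=
  if a = b then 0
  else if (b : ℕ) < (a : ℕ) then (if (b : ℕ) = 0 then Q n ^ (a : ℕ) - Q n else 0)
  else Q n ^ (a : ℕ) * (Q n - 1) + Q n ^ ((a : ℕ) + 1) * ((((b : ℕ) - (a : ℕ)).choose 2 : ℕ) : ℤ)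

/-- the design's valuation table (class-independent: the design is static). -/
def vv : Fin (n + 1) → Fin (n + 1) → Fin 3 → ℤ := fun a b _ => val n a b

/-- the MOUNTAIN map on naturals: `0 ↦ z`, `i ↦ i − 1` on `[1, z)`, `i ↦ i + 1` on `[z, z+y−1)`, `z+y−1 ↦ z−1`,
identity above. -/
def mf (y z i : ℕ) : ℕ :=
  if i = 0 then z else if i < z then i - 1 else if i + 1 < z + y then i + 1 else if i + 1 = z + y then z - 1 else i

/-- the inverse map of `mf y z`. -/
def mg (y z j : ℕ) : ℕ :=
  if j = z then 0 else if j + 1 < z then j + 1 else if j + 1 = z then z + y - 1 else if j < z + y then j - 1 else j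

/-- the mountain map stays inside `[0, m)`. -/
theorem mf_lt (y z : ℕ) (h : 1 ≤ y ∧ 1 ≤ z ∧ y + z ≤ n + 1) (i : ℕ) (hi : i < n + 1) : mf y z i < n + 1 := by
  unfold mf; split_ifs <;> first | contradiction | omega

/-- the inverse mountain map stays inside `[0, m)`. -/
theorem mg_lt (y z : ℕ) (h : 1 ≤ y ∧ 1 ≤ z ∧ y + z ≤ n + 1) (j : ℕ) (hj : j < n + 1) : mg y z j < n + 1 := by
  unfold mg; split_ifs <;> first | contradiction | omega

/-- `mg` is a left inverse of `mf`. -/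
theorem mg_mf (y z : ℕ) (h : 1 ≤ y ∧ 1 ≤ z ∧ y + z ≤ n + 1) (i : ℕ) : mg y z (mf y z i) = i := by
  unfold mf; split_ifs <;> unfold mg <;> split_ifs <;> first | contradiction | omega

/-- `mg` is a right inverse of `mf`. -/
theorem mf_mg (y z : ℕ) (h : 1 ≤ y ∧ 1 ≤ z ∧ y + z ≤ n + 1) (j : ℕ) : mf y z (mg y z j) = j := by
  unfold mg; split_ifs <;> unfold mf <;> split_ifs <;> first | contradiction | omega

/-- the mountain permutation for an admissible pair `(y, z)` (`y, z ≥ 1`, `y + z ≤ m`). -/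
def mtnEquiv (y z : ℕ) (h : 1 ≤ y ∧ 1 ≤ z ∧ y + z ≤ n + 1) : Equiv.Perm (Fin (n + 1)) where
  toFun i := ⟨mf y z i, mf_lt n y z h i i.isLt⟩
  invFun j := ⟨mg y z j, mg_lt n y z h j j.isLt⟩
  left_inv i := Fin.ext (mg_mf n y z h i)
  right_inv j := Fin.ext (mf_mg n y z h j)

/-- **the mountain permutation `M_{y,z}`**: the cycle `0 → z → z+1 → ⋯ → z+y−1 → z−1 → z−2 → ⋯ → 1 → 0` (with `y`
excedances and `z` anti-excedances, moving exactly the block `[0, y+z)`); the identity when `(y, z)` is not admissible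
(in particular `M_{0,0} = 1`). -/
def mtn (y z : ℕ) : Equiv.Perm (Fin (n + 1)) :=
  if h : 1 ≤ y ∧ 1 ≤ z ∧ y + z ≤ n + 1 then mtnEquiv n y z h else 1

/-- the rank of the grid point `(1, z)` in the chain order `(0,0), (1,1), …, (m−1,1), (1,2), …, (1,m−1)`:
`R 0 = 0`, `R 1 = 1`, `R (z+1) = R z + (m − z)`. -/
def R : ℕ → ℕ
  | 0 => 0
  | 1 => 1
  | z + 2 => R (z + 1) + (n - z)

/-- the sign carried by the column-`0` entry `(z, 0)` (used exactly by the mountains of block `z`):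
`(−1)^(R z) · sign M_{1,z}` — DEFINED through the sign of a mountain so that no cycle sign is ever computed. -/
def csign (z : ℕ) : ℤ := (-1) ^ R n z * (Equiv.Perm.sign (mtn n 1 z) : ℤ)

/-- the sign carried by the long descent `(z−1, z+y−1)` (private to `M_{y,z}`, `y ≥ 2`):
`(−1)^(y−1) · sign M_{y,z} · sign M_{1,z}`. -/
def lsign (y z : ℕ) : ℤ :=
  (-1) ^ (y - 1) * (Equiv.Perm.sign (mtn n y z) : ℤ) * (Equiv.Perm.sign (mtn n 1 z) : ℤ)

/-- presence-and-sign of the entry `(a, b)` (for its own class): diagonal `+1`; lower entries: column `0` carries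
`csign a`, unit ascents `(b+1, b)` carry `+1`, all other lower entries are ABSENT; upper entries: unit descents `+1`,
long descents `lsign (b − a) (a + 1)`. -/
def sgn (a b : Fin (n + 1)) : ℤ :=
  if a = b then 1
  else if (b : ℕ) < (a : ℕ) then (if (b : ℕ) = 0 then csign n a else if (a : ℕ) = (b : ℕ) + 1 then 1 else 0)
  else (if (b : ℕ) = (a : ℕ) + 1 then 1 else lsign n ((b : ℕ) - (a : ℕ)) ((a : ℕ) + 1))

/-- the design's presence/sign table: entry `(a, b)` carries only its sign-rule class `cls a b`. -/
def ee : Fin (n + 1) → Fin (n + 1) → Fin 3 → ℤ := fun a b l => if l = cls n a b then sgn n a b else 0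

/-- the Leibniz term of the mountain `M_{y,z}` (its class map is forced by the static sign rule). -/
def mterm (y z : ℕ) : Equiv.Perm (Fin (n + 1)) × (Fin (n + 1) → Fin 3) :=
  (mtn n y z, fun b => cls n (mtn n y z b) b)

/-- the integer slope at which `M_{y,z}` is the unique optimum: `θ(y,z) = Q^z·y − 1` (`θ(0,0) = −1`). -/
def th (y z : ℕ) : ℤ := Q n ^ z * (y : ℤ) - 1

/-- the cost of the mountain: `W(y,z) = 2Q^z − Q − 1 + Q^z·C(y,2)` (`W(·,0) = 0`). -/
def Wv (y z : ℕ) : ℤ := if z = 0 then 0 else 2 * Q n ^ z - Q n - 1 + Q n ^ z * ((y.choose 2 : ℕ) : ℤ)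

/-- the degree (exponent sum) of a term with `y` excedances and `z` anti-excedances: `y + (m+2)·z`. -/
def Dg (y z : ℕ) : ℤ := (y : ℤ) + ((n : ℤ) + 3) * (z : ℤ)

/-- cost of a permutation (sum of the valuations of its entries). -/
def cost (σ : Equiv.Perm (Fin (n + 1))) : ℤ := ∑ i, val n (σ i) i

/-- degree of a permutation under the sign rule: `∑_b d(cls(σ b, b))`. -/
def deg (σ : Equiv.Perm (Fin (n + 1))) : ℤ := ∑ i, (dd n (cls n (σ i) i) : ℤ)

/-- number of excedances (columns `b` with `σ b > b`). -/
def exc (σ : Equiv.Perm (Fin (n + 1))) : ℕ := (univ.filter (fun i : Fin (n + 1) => (i : ℕ) < (σ i : ℕ))).card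

/-- number of anti-excedances (columns `b` with `σ b < b`). -/
def aexc (σ : Equiv.Perm (Fin (n + 1))) : ℕ := (univ.filter (fun i : Fin (n + 1) => (σ i : ℕ) < (i : ℕ))).card

/-- the set of LANDING ROWS: rows entered by a descent. -/
def land (σ : Equiv.Perm (Fin (n + 1))) : Finset ℕ :=
  (univ.filter (fun i : Fin (n + 1) => (σ i : ℕ) < (i : ℕ))).image (fun i => ((σ i : Fin (n + 1)) : ℕ))

/-- one step of the chain enumeration on grid points `(z, y)`: `(0,0) ↦ (1,1)`, `(z,y) ↦ (z,y+1)` while `y + z < m`,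
else `(z+1, 1)`. -/
def step (x : ℕ × ℕ) : ℕ × ℕ :=
  if x.1 = 0 then (1, 1) else if x.2 + x.1 < n + 1 then (x.1, x.2 + 1) else (x.1 + 1, 1)

/-- the `k`-th grid point `(z_k, y_k)`. -/
def grid (k : ℕ) : ℕ × ℕ := (step n)^[k] (0, 0)

/-- the column-`0` cost of a permutation: `Q^c − Q` if `σ 0 = c > 0`, else `0`. -/
def c0 (σ : Equiv.Perm (Fin (n + 1))) : ℤ :=
  if 0 < ((σ 0 : Fin (n + 1)) : ℕ) then Q n ^ ((σ 0 : Fin (n + 1)) : ℕ) - Q n else 0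

/-- the per-column cost of the mountain, as a function on naturals. -/
def gcost (y z i : ℕ) : ℤ :=
  if i = 0 then Q n ^ z - Q n
  else if i < z then Q n ^ (i - 1) * (Q n - 1)
  else if i + 1 < z + y then 0
  else if i + 1 = z + y then Q n ^ (z - 1) * (Q n - 1) + Q n ^ z * ((y.choose 2 : ℕ) : ℤ)
  else 0

/-- the per-column degree of the mountain. -/
def gdeg (y z i : ℕ) : ℤ :=
  if i = 0 then 1 else if i < z then (n : ℤ) + 3 else if i + 1 < z + y then 1 else if i + 1 = z + y then (n : ℤ) + 3
  else 0

/-- the anti-excedance indicator of the mountain. -/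
def gaexc (y z i : ℕ) : ℕ :=
  if i = 0 then 0 else if i < z then 1 else if i + 1 < z + y then 0 else if i + 1 = z + y then 1 else 0

/-- the entry signs met by the mountain, as a function on naturals: `csign z` in column `0`, `lsign y z` at the long
descent (`y ≥ 2`), `+1` elsewhere. -/
def gsgn (y z i : ℕ) : ℤ := if i = 0 then csign n z else if i + 1 = z + y ∧ 2 ≤ y then lsign n y z else 1

end Mountain

end Summit.ValiantsHypothesis.ValiantsHypothesis.Theorems.LacunarySymmetroidMatrixDescartes.TropicalCensus
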